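import Summits.FinalStateConjecture.FinalStateConjecture.Theses.SwallowTheDatum
import Summits.FinalStateConjecture.FinalStateConjecture.Theorems.SwallowTheDatumKerrShieldedSettlesStubCollarEmbedsMGHD
import Summits.FinalStateConjecture.FinalStateConjecture.Theorems.SwallowTheDatumKerrShieldedSettlesStubCollarCauchy
import Summits.FinalStateConjecture.FinalStateConjecture.Theorems.SwallowTheDatumKerrShieldedSettlesStubKerrVacuumHolds
import Summits.FinalStateConjecture.FinalStateConjecture.Theorems.PhotonSphereChannelsTameCensorshipExactKerrVisible
import Literature.Geometry.Lorentzian.KerrExactRegionFacts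
import HarnessLib

/-!
# Crux `TameCensorship` (stmt-FinalStateConjecture-10047), line `crush-the-swallowed-interior`:
# stub B `stub_exactKerrBookkeeping` from the four named Kerr facts

The registered stub B of the lead's skeleton
(`Cruxes/TameCensorship/Lines/crush_the_swallowed_interior.lean`) — for a Kerr-shielded admissible
datum and any maximal vacuum Cauchy development: (B1) the exact part `E = J⁺(ιX) ∖ J⁺(ιK)` is
covered by a smooth local isometry into `Kerr.spacetime M a r₋`, (B2) `J⁺(ιK)` is future closed,
(B3) the black hole is mortal inside `E`, (B4) visible points of `E` carry uniform tame charts —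
proved VERBATIM under the four named facts of
`Literature/Geometry/Lorentzian/KerrExactRegionFacts.lean` (statements only, cited there):
`KerrLeafExactPartChart` (F1: the exact part is a piece of Kerr — maximality of the Kerr domain of
dependence of the bent leaf), `KerrBlackHoleBoundedTimeSeparation` (F3),
`KerrBlackHoleNoCompleteNullRay` (F4a), `KerrVisibleExteriorUniformCharts` (F4). The route item
`SubdataDevelopmentsEmbed` (stmt-FinalStateConjecture-10053) is used, by name, through
`KerrShieldedSettles.stub_collarEmbedsMGHD` (the collar chart which F1 inverts and extends).
The conjunct proofs are `causalFuture_singleton_subset_swallowed`, `lorentzDist_le_of_exactKerrChart`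
(`…ExactKerrRegion.lean`) and `ballChart_or_swallowed_of_exactKerrChart` (`…ExactKerrVisible.lean`).

References: Choquet-Bruhat–Geroch 1969, Thm. 3; Hawking–Ellis 1973, §7.6; O'Neill 1995, Ch. 2,
§2.5–§2.7, Ch. 4, §4.2–§4.3; Dafermos–Holzegel–Rodnianski–Taylor arXiv:2104.08222, §1.
-/

set_option linter.dupNamespace false

noncomputable section

open scoped Manifold ContDiff Topology ENNReal NNReal
open Set Filter Bundle
open Literature.Geometry.Lorentzian
open Summit.FinalStateConjecture.FinalStateConjecture.Theses.SwallowTheDatum (SubdataDevelopmentsEmbed)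
open Summit.FinalStateConjecture.FinalStateConjecture.Theorems.KerrShieldedDataExist.Negative
  (bentHeight bentHeight_eq_literal graph psi_eq_graph mass_pos)
open Summit.FinalStateConjecture.FinalStateConjecture.Theorems.SwallowTheDatum

namespace Summit.FinalStateConjecture.FinalStateConjecture.Theorems.PhotonSphereChannels.TameCensorshipCrush

/-- **The shield's first pull-back identity, pointwise**: from `φ^*h = ψ^*g_{M,a}` as an equality
of pulled-back forms, `h(dφ v, dφ w) = g_{M,a}(dψ v, dψ w)` (the shape consumed by
`KerrShieldedSettles.stub_collarEmbedsMGHD` and by `KerrLeafExactPartChart`). [folklore] -/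
theorem inner_mfderiv_eq_of_pullbackBilin_eq [Kerr.Facts] {X : Type} [TopologicalSpace X]
    [ChartedSpace E3 X] [IsManifold (𝓡 3) ((⊤ : ℕ∞) : WithTop ℕ∞) X]
    (D : InitialDataSet (𝓡 3) X) {M a r₁ : ℝ} {φ : Kerr.slice a r₁ → X}
    {ψ : Kerr.slice a r₁ → Kerr.region a r₁}
    (hh : ∀ y : Kerr.slice a r₁, (pullbackBilin φ D.h.inner y :
      TangentSpace 𝓘(ℝ, E3) y →L[ℝ] TangentSpace 𝓘(ℝ, E3) y →L[ℝ] ℝ) =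
        pullbackBilin ψ (Kerr.smoothMetric M a r₁).val y)
    (y : Kerr.slice a r₁) (v w : E3) :
    D.h.inner (φ y) (mfderiv 𝓘(ℝ, E3) (𝓡 3) φ y v) (mfderiv 𝓘(ℝ, E3) (𝓡 3) φ y w) =
      Kerr.bilin M a (ψ y : E4) (mfderiv 𝓘(ℝ, E3) 𝓘(ℝ, E4) ψ y v)
        (mfderiv 𝓘(ℝ, E3) 𝓘(ℝ, E4) ψ y w) := by
  -- adapted from `SwallowTheDatum.kerrShieldedSettles_proof`
  have h := congrArg (fun b ↦ b v w) (hh y)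
  simp only [pullbackBilin_apply, Kerr.smoothMetric_val] at h
  convert h using 2 <;> rfl

/-- **Stub B of the line `crush-the-swallowed-interior` from the four named Kerr facts**
(`exactKerrBookkeeping_of_facts`): given `KerrLeafExactPartChart` (F1: the exact part of an MGHD
of Kerr-shielded data is a piece of Kerr), `KerrBlackHoleBoundedTimeSeparation` (F3: block II has
finite timelike diameter), `KerrBlackHoleNoCompleteNullRay` (F4a: null geodesics of block II are
future-incomplete in `{r > r₋}`) and `KerrVisibleExteriorUniformCharts` (F4: uniform framed
Kerr–Schild balls at visible points above the leaf), the registered statement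
`stub_exactKerrBookkeeping` holds VERBATIM: `SubdataDevelopmentsEmbed →` for every Kerr-shielded
admissible datum and every maximal vacuum Cauchy development `𝒟`, with `K = (range φ)ᶜ`,
`swallowed = J⁺(ιK)`, `E = J⁺(ιX) ∖ swallowed`: (B1) `E ⊆ E'`, `E'` open, with a smooth local
isometry `χ : E' → Kerr.spacetime M a r₋`; (B2) `swallowed` is future closed; (B3) one `C` bounds
`d(p, q)` for `p, q ∈ E`, `r(χ p) < r₊`; (B4) uniform tame charts at the visible points.
Assembly: the shield is unpacked and `T` pinned to `bentHeight M a` (`bentHeight_eq_literal`); the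
collar chart `χ'` of the tapered collar is `KerrShieldedSettles.stub_collarEmbedsMGHD` (fed
`stub_collarCauchy`, `stub_kerrVacuum` and `SubdataDevelopmentsEmbed`); F1 turns it into the exact-Kerr
chart `(E', χ)`; (B1) is its isometry clause, (B2) is `causalFuture_singleton_subset_swallowed`,
(B3) is `lorentzDist_le_of_exactKerrChart` fed F3, (B4) is `ballChart_or_swallowed_of_exactKerrChart`
fed F4a and F4 (the leaf clauses by `radius_graph`, `graph_apply_zero`, `graph_mem_collar`).
[cite: ChoquetBruhatGeroch1969CMP, Thm. 3 (p. 332)] [cite: ONeill1995, Ch. 2, §2.5–§2.7 and Ch. 4, §4.2–§4.3] -/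
theorem exactKerrBookkeeping_of_facts (hF1 : KerrLeafExactPartChart)
    (hF3 : KerrBlackHoleBoundedTimeSeparation) (hF4a : KerrBlackHoleNoCompleteNullRay)
    (hF4 : KerrVisibleExteriorUniformCharts) : ∀ [Kerr.Facts], SubdataDevelopmentsEmbed →
    ∀ (X : Type) [TopologicalSpace X] [ChartedSpace E3 X] [IsManifold (𝓡 3) ∞ X] [T2Space X]
      [SecondCountableTopology X] [ConnectedSpace X],
    ∀ D ∈ admissibleVacuumData X,
    ∀ (M a r₁ : ℝ) (hM : 0 ≤ M) (T : ℝ → ℝ) (φ : Kerr.slice a r₁ → X)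
      (ψ : Kerr.slice a r₁ → Kerr.region a r₁) (ν : NormalField 𝓘(ℝ, E4) ψ),
      (|a| < M ∧ Kerr.rMinus M a < r₁ ∧ r₁ < Kerr.rPlus M a ∧
        T = (fun r : ℝ => Real.smoothTransition (r / (4 * M) - 1) * (((M) / Real.sqrt ((M) ^ 2 - (a) ^ 2)) * (Kerr.rPlus M a * Real.log (r - Kerr.rPlus M a) - Kerr.rMinus M a * Real.log (r - Kerr.rMinus M a)) - ((M) / Real.sqrt ((M) ^ 2 - (a) ^ 2)) * (Kerr.rPlus M a * Real.log ((4 * M) - Kerr.rPlus M a) - Kerr.rMinus M a * Real.log ((4 * M) - Kerr.rMinus M a)))) ∧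
        IsCompact (Set.range φ)ᶜ ∧ Topology.IsOpenEmbedding φ ∧ ContMDiff 𝓘(ℝ, E3) (𝓡 3) ((⊤ : ℕ∞) : WithTop ℕ∞) φ ∧
        (∀ y : Kerr.slice a r₁, (ψ y : E4) = E4.ofTimeSpace (T (Kerr.radius a (E4.ofTimeSpace 0 (y : E3)))) (y : E3)) ∧
        (Kerr.smoothMetric M a r₁).IsSpacelikeImmersion 𝓘(ℝ, E3) ψ ∧
        (Kerr.smoothMetric M a r₁).IsFutureUnitNormal 𝓘(ℝ, E3) ((Kerr.timeOrientation M a r₁ hM).ofLE le_top) ψ ν ∧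
        (∀ y : Kerr.slice a r₁, (pullbackBilin φ D.h.inner y : TangentSpace 𝓘(ℝ, E3) y →L[ℝ] TangentSpace 𝓘(ℝ, E3) y →L[ℝ] ℝ) = pullbackBilin ψ (Kerr.smoothMetric M a r₁).val y) ∧
        (∀ [(Kerr.smoothMetric M a r₁).HasLeviCivita] (y : Kerr.slice a r₁), (pullbackBilin φ D.k y : TangentSpace 𝓘(ℝ, E3) y →L[ℝ] TangentSpace 𝓘(ℝ, E3) y →L[ℝ] ℝ).toLinearMap₁₂ = (Kerr.smoothMetric M a r₁).secondFundamentalForm 𝓘(ℝ, E3) ψ ν y)) →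
    ∀ 𝒟 : VacuumCauchyDevelopment D, 𝒟.IsMaximal → ∀ [𝒟.metric.HasLeviCivita],
      ∃ (E' : Set 𝒟.carrier) (χ : 𝒟.carrier → (Kerr.spacetime M a (Kerr.rMinus M a) hM).carrier),
        (𝒟.metric.causalFuture 𝒟.timeOrientation (Set.range 𝒟.embed) \
            𝒟.metric.causalFuture 𝒟.timeOrientation (𝒟.embed '' (Set.range φ)ᶜ)) ⊆ E' ∧
        (IsOpen E' ∧ ContMDiffOn (𝓡 4) (𝓡 4) ∞ χ E' ∧
          ∀ p ∈ E', pullbackBilin χ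
            (Kerr.spacetime M a (Kerr.rMinus M a) hM).metric.val p = 𝒟.metric.val p) ∧
        (∀ m ∈ 𝒟.metric.causalFuture 𝒟.timeOrientation (𝒟.embed '' (Set.range φ)ᶜ),
          𝒟.metric.causalFuture 𝒟.timeOrientation {m} ⊆
            𝒟.metric.causalFuture 𝒟.timeOrientation (𝒟.embed '' (Set.range φ)ᶜ)) ∧
        (∃ C : ℝ≥0, ∀ p ∈ (𝒟.metric.causalFuture 𝒟.timeOrientation (Set.range 𝒟.embed) \
            𝒟.metric.causalFuture 𝒟.timeOrientation (𝒟.embed '' (Set.range φ)ᶜ)),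
          Kerr.radius a (χ p).1 < Kerr.rPlus M a →
          ∀ q ∈ (𝒟.metric.causalFuture 𝒟.timeOrientation (Set.range 𝒟.embed) \
            𝒟.metric.causalFuture 𝒟.timeOrientation (𝒟.embed '' (Set.range φ)ᶜ)),
            𝒟.toSpacetime.lorentzDist p q ≤ (C : ℝ≥0∞)) ∧
        (∃ rb : ℝ, 0 < rb ∧ ∀ r' : ℝ, 0 < r' → r' ≤ rb → ∃ Λb : ℝ≥0,
          ∀ q ∈ 𝒟.metric.causalFuture 𝒟.timeOrientation (Set.range 𝒟.embed),
          ∀ (p : X) (γ : ℝ → 𝒟.carrier) (dom : Set ℝ),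
            𝒟.metric.IsNormalisedNullRayFrom 𝒟.timeOrientation 𝒟.embed 𝒟.normal p γ dom →
            ¬ BddAbove dom →
            q ∈ 𝒟.metric.chronologicalPast 𝒟.timeOrientation (γ '' (dom ∩ Set.Ici 0)) →
            (γ '' (dom ∩ Set.Ici 0) ∩
                𝒟.metric.causalFuture 𝒟.timeOrientation (𝒟.embed '' (Set.range φ)ᶜ)).Nonempty ∨
              ∃ Φ : (⟨Metric.ball (0 : E4) r', Metric.isOpen_ball⟩ : TopologicalSpace.Opens E4) → 𝒟.carrier,
                𝒟.toSpacetime.IsLateChart (Minkowski.backgroundOn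
                  (⟨Metric.ball (0 : E4) r', Metric.isOpen_ball⟩ : TopologicalSpace.Opens E4)) Set.univ (-r') Φ ∧
                (∃ x : (⟨Metric.ball (0 : E4) r', Metric.isOpen_ball⟩ : TopologicalSpace.Opens E4),
                  (x : E4) = 0 ∧ Φ x = q) ∧
                supCkENorm ((⟨Metric.ball (0 : E4) r', Metric.isOpen_ball⟩ : TopologicalSpace.Opens E4) : Set E4) 3
                  (𝒟.toSpacetime.deviationExtend (Minkowski.backgroundOn
                    (⟨Metric.ball (0 : E4) r', Metric.isOpen_ball⟩ : TopologicalSpace.Opens E4)) Φ) ≤ (Λb : ℝ≥0∞) ∧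
                supCkENorm ((⟨Metric.ball (0 : E4) r', Metric.isOpen_ball⟩ : TopologicalSpace.Opens E4) : Set E4) 0
                  (𝒟.toSpacetime.deviationExtend (Minkowski.backgroundOn
                    (⟨Metric.ball (0 : E4) r', Metric.isOpen_ball⟩ : TopologicalSpace.Opens E4)) Φ) ≤ 1 / 2) := by
  intro _ hE X _ _ _ _ _ _ D hD M a r₁ hM T φ ψ ν hsh 𝒟 hmax _
  obtain ⟨ha, hr₁, hr₂, hT, hK, hφo, hφs, hψ, hsp, hν, hh, hk⟩ := hsh
  have hM0 : 0 < M := mass_pos ha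
  -- pin the height: `T = bentHeight M a`
  have hTb : T = bentHeight M a := hT.trans (bentHeight_eq_literal M a).symm
  subst hTb
  -- the two pull-back identities, pointwise
  have hh' := inner_mfderiv_eq_of_pullbackBilin_eq D hh
  have hk' : ∀ [(Kerr.smoothMetric M a r₁).HasLeviCivita] (y : Kerr.slice a r₁) (v w : E3),
      D.k (φ y) (mfderiv 𝓘(ℝ, E3) (𝓡 3) φ y v) (mfderiv 𝓘(ℝ, E3) (𝓡 3) φ y w) =
        (Kerr.smoothMetric M a r₁).secondFundamentalForm 𝓘(ℝ, E3) ψ ν y v w := by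
    intro _ y v w
    have h := congrArg (fun B ↦ B v w) (hk y)
    simp only [ContinuousLinearMap.toLinearMap₁₂_apply, pullbackBilin_apply] at h
    convert h using 2
  -- the collar chart of the tapered collar (KerrShieldedSettles S3, fed S1, S2 and `hE`)
  obtain ⟨χ', h1, h2, h3, h4, h5⟩ :=
    KerrShieldedSettles.stub_collarEmbedsMGHD hE X D M a r₁ hM φ ψ ν ha hr₁ hr₂ hφo hφs hψ hsp hν
      hh' hk' (KerrShieldedSettles.stub_collarCauchy M a r₁ hM ha hr₁ hr₂)
      (KerrShieldedSettles.stub_kerrVacuum M a r₁) 𝒟 hmax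
  -- F1: the exact-Kerr chart
  obtain ⟨E', χ, hEE', hE'o, hχs, hχi, hχg, hχW⟩ := hF1 X D M a r₁ hM (bentHeight M a) φ ψ ν ha
    hr₁ hr₂ hT hK hφo hφs hψ hsp hν hh' hk' 𝒟 hmax χ' h1 h2 h3 h4 h5
  refine ⟨E', χ, hEE', ⟨hE'o, hχs, fun p hp ↦ ?_⟩, ?_, ?_, ?_⟩
  · -- (B1) the isometry clause
    ext v w
    rw [pullbackBilin_apply]
    exact (hχg p hp).1 v w
  · -- (B2)
    exact fun m hm ↦ causalFuture_singleton_subset_swallowed 𝒟.toCauchyDevelopment _ hm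
  · -- (B3) from F3
    obtain ⟨C, hC⟩ := hF3 M a hM ha
    exact ⟨C, fun p hp hpr q hq ↦ lorentzDist_le_of_exactKerrChart 𝒟.toCauchyDevelopment
      (Set.range φ)ᶜ hM hEE' hE'o hχs hχg hC hp hpr hq⟩
  · -- (B4) from F4a and F4
    -- the leaf `ψ = graph M a r₁` and its collar clauses
    obtain rfl : ψ = graph M a r₁ := psi_eq_graph rfl hψ
    have hψr : ∀ y, r₁ < Kerr.radius a (graph M a r₁ y : E4) := fun y ↦ by
      rw [KerrShieldedSettles.CollarEmbedsMGHD.radius_graph]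
      exact KerrShieldedSettles.CollarEmbedsMGHD.lt_radius_slice y
    have hψT : ∀ y, (graph M a r₁ y : E4) 0 =
        bentHeight M a (Kerr.radius a (graph M a r₁ y : E4)) := fun y ↦ by
      rw [KerrShieldedSettles.CollarEmbedsMGHD.graph_apply_zero,
        KerrShieldedSettles.CollarEmbedsMGHD.radius_graph]
    have hψC : ∀ y, 0 < (graph M a r₁ y : E4) 0 -
        bentHeight M a (Kerr.radius a (graph M a r₁ y : E4)) +
          (Kerr.radius a (graph M a r₁ y : E4) - r₁) / 4 := fun y ↦
      KerrShieldedSettles.CollarEmbedsMGHD.graph_mem_collar hM0 y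
    have hCo : IsOpen {x : Kerr.region a r₁ | 0 < (x : E4) 0 -
        bentHeight M a (Kerr.radius a (x : E4)) + (Kerr.radius a (x : E4) - r₁) / 4} :=
      (KerrShieldedSettles.CollarEmbedsMGHD.collar M a r₁ hM0).2
    obtain ⟨rb, hrb, hF4'⟩ := hF4 M a r₁ hM (bentHeight M a) ha hr₁ hr₂ hT
    refine ⟨rb, hrb, fun r' hr' hr'b ↦ ?_⟩
    obtain ⟨Λ, hΛ⟩ := hF4' r' hr' hr'b
    refine ⟨Λ, fun q hq p γ dom hray hdom hqI ↦ ?_⟩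
    haveI : Fact ((1 : ℕ∞ω) ≤ ((⊤ : ℕ∞) : WithTop ℕ∞)) := ⟨by exact_mod_cast le_top⟩
    haveI : (Kerr.spacetime M a (Kerr.rMinus M a) hM).metric.HasLeviCivita :=
      (Kerr.spacetime M a (Kerr.rMinus M a) hM).metric.toPseudoRiemannianMetric.hasLeviCivita
    exact ballChart_or_swallowed_of_exactKerrChart 𝒟.toCauchyDevelopment hM hψr hψT hψC hCo h1 h2
      (fun x hx v w ↦ (h3 x hx).1 v w) h4 hEE' hE'o hχs hχi hχg hχW (hF4a M a hM ha) hr' hΛ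
      hq hray hdom hqI

end Summit.FinalStateConjecture.FinalStateConjecture.Theorems.PhotonSphereChannels.TameCensorshipCrush

end
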